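import Literature.NumberTheory.Automorphic.GL2CasimirScalar
import Literature.NumberTheory.Automorphic.HarishChandraGLIsomorphism
import Literature.RingTheory.MvPolynomial.BlockSymmetric
import Mathlib.Algebra.MvPolynomial.Funext
import HarnessLib

/-!
# `Z(𝔤𝔩₂(ℝ))` acts by a character on any vector with Casimir and central eigenvalues

Topic `NumberTheory/Automorphic`; theorems only (no definition, no named fact; D-0026). Let `ρ` be a
real Lie algebra representation of `𝔤𝔩₂(ℝ)` on a complex vector space `V` and `v ∈ V` a vector on
which the Casimir element `C = ∑ E_{ab}E_{ba}` and the centre `Z = ι(1)` of `U(𝔤𝔩₂(ℝ))` act by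
scalars, `C v = (s₁² + s₂² - ½) v`, `Z v = (s₁ + s₂) v`. Then EVERY element `u` of the centre
`Z(𝔤𝔩₂(ℝ))` of `U(𝔤𝔩₂(ℝ))` acts on `v` by a scalar, namely `γ(u)(s₁, s₂)` for the Harish-Chandra
homomorphism `γ` (`harishChandraHomGL ℝ 2`): `Z(𝔤) v ⊆ ℂ v`, so `v` is `Z(𝔤)`-finite. Proof:
Harish-Chandra's isomorphism (`HarishChandraHomGL.baseChange_injective_and_range_eq`: the
complexification `γ_ℂ : ℂ ⊗_ℝ Z(𝔤) → ℂ[x₁, x₂]^{𝔖₂}` is bijective) and the fundamental theorem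
of symmetric polynomials in power-sum form (`BlockSymmetric.range_blockPsumAeval`: `x₁ + x₂` and
`x₁² + x₂²` generate) show that `ℂ ⊗_ℝ Z(𝔤)` is generated by `1 ⊗ Z` and `1 ⊗ C`
(`γ(Z) = x₁ + x₂`, `γ(C) = x₁² + x₂² - ½`, `GL2Casimir.aeval_harishChandra_zedZ/casimirZ`), and the
elements of `ℂ ⊗ Z(𝔤)` acting on `v` by the predicted scalar form a subalgebra. This is the
classical statement "`Z(U(𝔤𝔩₂)) = ℂ[Z, Ω]`" (Bump 1997, §2.2, Thm. 2.2.1 ff.; Knapp 2002,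
Thm. 5.44) in the form needed to prove that an eigenfunction of the Casimir operator with a
central character — e.g. the adelic lift of a holomorphic modular form of weight `k`,
`Ω = k(k-2)/2`, `Z = 0` — is `Z(𝔤)`-finite, one of the defining properties of an automorphic form
(Borel–Jacquet 1979, 4.2 (c)).

* `GL2Casimir.harishChandra_zedZ_eq`, `GL2Casimir.harishChandra_casimirZ_eq` — `γ(Z)`, `γ(C)` as
  polynomials (block power sums), from their values (`MvPolynomial.funext`);
* `GL2Casimir.lift_center_apply_eq_smul_of_casimir_of_zed` — the theorem;
* `GL2Casimir.exists_character_lift_center_apply_eq_smul` — packaged: a character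
  `θ : Z(𝔤) →ₐ[ℝ] ℂ` with `u v = θ(u) v` for all central `u`, `θ(Z) = s₁ + s₂`,
  `θ(C) = s₁² + s₂² - ½`.

## References

* D. Bump, *Automorphic Forms and Representations* (1997), §2.2. [Bump1997]
* A. W. Knapp, *Lie Groups Beyond an Introduction*, 2nd ed. (2002), §V.5, Thm. 5.44. [Knapp2002]
* A. Borel, H. Jacquet, *Automorphic forms and automorphic representations*, Corvallis 1979,
  4.2 (c), 1.6. [BorelJacquet1979]
-/

noncomputable section

-- Mathlib idiom (Mathlib/Algebra/Lie/OfAssociative.lean), as in `GL2CasimirScalar` and `HarishChandraGL`: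
-- the Lie bracket on `Matrix (Fin 2) (Fin 2) ℝ` is the commutator.
attribute [local instance 100] LieRing.ofAssociativeRing

open scoped TensorProduct
open UniversalEnvelopingAlgebra MvPolynomial

namespace Literature.NumberTheory.Automorphic

namespace GL2Casimir

open GLnCasimir HCSpan Literature.RingTheory.MvPolynomial.BlockSymmetric

/-- **`γ(Z) = x_{τ,0} + x_{τ,1}`** as a polynomial (the block power sum `p₁`), for every
Harish-Chandra homomorphism `γ` of `𝔤𝔩₂(ℝ)` and the (unique) `τ : ℝ →ₐ[ℝ] ℂ`: two complex
polynomials with the same values are equal (`MvPolynomial.funext`), and the values are given by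
`aeval_harishChandra_zedZ`. [cite: Knapp2002, Thm. 5.44] -/
theorem harishChandra_zedZ_eq (γ : HarishChandraHomGL ℝ 2) (τ : ℝ →ₐ[ℝ] ℂ) :
    γ.toAlgHom (zedZ 2) = bpsum ℂ τ 1 := by
  apply MvPolynomial.funext
  intro x
  have h := aeval_harishChandra_zedZ γ (fun σ i => x (σ, i)) τ
  have hx : (fun p : (ℝ →ₐ[ℝ] ℂ) × Fin 2 => (fun σ i => x (σ, i)) p.1 p.2) = x := by
    funext p; rfl
  rw [hx, MvPolynomial.aeval_eq_eval] at h
  · rw [show (MvPolynomial.eval x) (γ.toAlgHom (zedZ 2)) = x (τ, 0) + x (τ, 1) from ?_]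
    · simp [bpsum, psum, Fin.sum_univ_two]
    · simpa using h

/-- **`γ(C) = x_{τ,0}² + x_{τ,1}² - ½`** as a polynomial (`p₂ - ½`). [cite: Knapp2002, Thm. 5.44] -/
theorem harishChandra_casimirZ_eq (γ : HarishChandraHomGL ℝ 2) (τ : ℝ →ₐ[ℝ] ℂ) :
    γ.toAlgHom (casimirZ 2) = bpsum ℂ τ 2 - C (1 / 2 : ℂ) := by
  apply MvPolynomial.funext
  intro x
  have h := aeval_harishChandra_casimirZ γ (fun σ i => x (σ, i)) τ
  have hx : (fun p : (ℝ →ₐ[ℝ] ℂ) × Fin 2 => (fun σ i => x (σ, i)) p.1 p.2) = x := by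
    funext p; rfl
  rw [hx, MvPolynomial.aeval_eq_eval] at h
  · rw [show (MvPolynomial.eval x) (γ.toAlgHom (casimirZ 2)) = x (τ, 0) ^ 2 + x (τ, 1) ^ 2 - 1 / 2 from ?_]
    · simp [bpsum, psum, Fin.sum_univ_two]
    · simpa using h

/-! ### The centre acts by scalars on a vector with Casimir and central eigenvalues -/

section Main

variable {V : Type*} [AddCommGroup V] [Module ℂ V]
  (ρ : Matrix (Fin 2) (Fin 2) ℝ →ₗ⁅ℝ⁆ Module.End ℂ V)

set_option maxHeartbeats 1600000 in
/-- **Every element of `Z(𝔤𝔩₂(ℝ))` acts by a scalar on a vector with Casimir and central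
eigenvalues.** If `C v = (s₁² + s₂² - ½) v` and `Z v = (s₁ + s₂) v` (`C`, `Z = ι(1)` the
Casimir and central elements of `U(𝔤𝔩₂(ℝ))`, `GLnCasimir.casimir/zed`), then for every `u` in the
centre of `U(𝔤𝔩₂(ℝ))`, `u v = γ(u)(s₁, s₂) · v`, `γ = harishChandraHomGL ℝ 2`. Proof: the elements
`w` of `ℂ ⊗_ℝ Z(𝔤)` with `w v = γ_ℂ(w)(s₁, s₂) v` form a `ℂ`-subalgebra containing `1 ⊗ Z` and
`1 ⊗ C` (`harishChandra_zedZ_eq`, `harishChandra_casimirZ_eq`); by Harish-Chandra's isomorphism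
(`baseChange_injective_and_range_eq`) and the power-sum form of the fundamental theorem of
symmetric polynomials (`range_blockPsumAeval`: `x₁ + x₂ = γ(Z)` and `x₁² + x₂² = γ(C) + ½`
generate `ℂ[x₁, x₂]^{𝔖₂}`) these two generate `ℂ ⊗_ℝ Z(𝔤)`. Bump 1997, §2.2 ("`Z(U(𝔤𝔩₂))` is
generated by `Z` and `Δ`"); Knapp 2002, Thm. 5.44. [cite: Knapp2002, §V.5 Thm. 5.44] [cite: Bump1997, §2.2] -/
theorem lift_center_apply_eq_smul_of_casimir_of_zed {v : V} {s₁ s₂ : ℂ}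
    (hC : lift ℝ ρ (casimir 2) v = (s₁ ^ 2 + s₂ ^ 2 - 1 / 2) • v)
    (hZ : lift ℝ ρ (zed 2) v = (s₁ + s₂) • v)
    (u : Subalgebra.center ℝ (UniversalEnvelopingAlgebra ℝ (Matrix (Fin 2) (Fin 2) ℝ))) :
    lift ℝ ρ (u : UniversalEnvelopingAlgebra ℝ (Matrix (Fin 2) (Fin 2) ℝ)) v =
      (MvPolynomial.aeval (fun p : (ℝ →ₐ[ℝ] ℂ) × Fin 2 => (![s₁, s₂] : Fin 2 → ℂ) p.2)
        ((harishChandraHomGL ℝ 2).toAlgHom u)) • v := by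
  classical
  set γ : HarishChandraHomGL ℝ 2 := harishChandraHomGL ℝ 2 with hγ
  let τ₀ : ℝ →ₐ[ℝ] ℂ := Algebra.ofId ℝ ℂ
  set ev : MvPolynomial ((ℝ →ₐ[ℝ] ℂ) × Fin 2) ℂ →ₐ[ℂ] ℂ :=
    MvPolynomial.aeval (fun p : (ℝ →ₐ[ℝ] ℂ) × Fin 2 => (![s₁, s₂] : Fin 2 → ℂ) p.2) with hev
  -- the centre, its complexification, and the complexified action on `V`
  let actZ : (Subalgebra.center ℝ (UniversalEnvelopingAlgebra ℝ (Matrix (Fin 2) (Fin 2) ℝ))) →ₐ[ℝ] Module.End ℂ V := (lift ℝ ρ).comp (Subalgebra.center ℝ (UniversalEnvelopingAlgebra ℝ (Matrix (Fin 2) (Fin 2) ℝ))).val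
  let act : ℂ ⊗[ℝ] (Subalgebra.center ℝ (UniversalEnvelopingAlgebra ℝ (Matrix (Fin 2) (Fin 2) ℝ))) →ₐ[ℂ] Module.End ℂ V :=
    Algebra.TensorProduct.lift (Algebra.ofId ℂ (Module.End ℂ V)) actZ
      fun c z => Algebra.commute_algebraMap_left c (actZ z)
  have hact : ∀ (c : ℂ) (z : (Subalgebra.center ℝ (UniversalEnvelopingAlgebra ℝ (Matrix (Fin 2) (Fin 2) ℝ)))), act (c ⊗ₜ z) = c • lift ℝ ρ (z : UniversalEnvelopingAlgebra ℝ _) := by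
    intro c z
    change Algebra.TensorProduct.lift _ _ _ (c ⊗ₜ z) = _
    rw [Algebra.TensorProduct.lift_tmul, Algebra.ofId_apply, Algebra.smul_def]
    rfl
  -- the complexified character `ev ∘ γ_ℂ`
  let θC : ℂ ⊗[ℝ] (Subalgebra.center ℝ (UniversalEnvelopingAlgebra ℝ (Matrix (Fin 2) (Fin 2) ℝ))) →ₐ[ℂ] ℂ := ev.comp γ.baseChange
  have hθC : ∀ (c : ℂ) (z : (Subalgebra.center ℝ (UniversalEnvelopingAlgebra ℝ (Matrix (Fin 2) (Fin 2) ℝ)))), θC (c ⊗ₜ z) = c * ev (γ.toAlgHom z) := by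
    intro c z
    change ev (γ.baseChange (c ⊗ₜ z)) = _
    rw [HarishChandraHomGL.baseChange_tmul, map_smul, smul_eq_mul]
  -- the subalgebra of elements acting by the predicted scalar
  let S : Subalgebra ℂ (ℂ ⊗[ℝ] (Subalgebra.center ℝ (UniversalEnvelopingAlgebra ℝ (Matrix (Fin 2) (Fin 2) ℝ)))) :=
    { carrier := {w | act w v = θC w • v}
      mul_mem' := fun {w₁ w₂} h₁ h₂ => by
        simp only [Set.mem_setOf_eq] at h₁ h₂ ⊢
        rw [map_mul, Module.End.mul_apply, h₂, LinearMap.map_smul, h₁, smul_smul, map_mul, mul_comm]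
      add_mem' := fun {w₁ w₂} h₁ h₂ => by
        simp only [Set.mem_setOf_eq] at h₁ h₂ ⊢
        rw [map_add, LinearMap.add_apply, h₁, h₂, map_add, add_smul]
      algebraMap_mem' := fun c => by
        simp only [Set.mem_setOf_eq]
        rw [AlgHom.commutes, AlgHom.commutes, Module.algebraMap_end_apply]
        rfl }
  have hS : ∀ w, w ∈ S ↔ act w v = θC w • v := fun w => Iff.rfl
  -- `1 ⊗ Z ∈ S` and `1 ⊗ C ∈ S`
  have hZmem : (1 : ℂ) ⊗ₜ zedZ 2 ∈ S := by
    rw [hS, hact, one_smul, hθC, one_mul]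
    change lift ℝ ρ (zed 2) v = _
    rw [hZ]
    congr 1
    have h := aeval_harishChandra_zedZ γ (fun _ => ![s₁, s₂]) τ₀
    rw [show (fun p : (ℝ →ₐ[ℝ] ℂ) × Fin 2 => (fun _ : ℝ →ₐ[ℝ] ℂ => (![s₁, s₂] : Fin 2 → ℂ)) p.1 p.2) =
        fun p : (ℝ →ₐ[ℝ] ℂ) × Fin 2 => (![s₁, s₂] : Fin 2 → ℂ) p.2 from rfl] at h
    rw [hev, h]
    simp
  have hCmem : (1 : ℂ) ⊗ₜ casimirZ 2 ∈ S := by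
    rw [hS, hact, one_smul, hθC, one_mul]
    change lift ℝ ρ (casimir 2) v = _
    rw [hC]
    congr 1
    have h := aeval_harishChandra_casimirZ γ (fun _ => ![s₁, s₂]) τ₀
    rw [show (fun p : (ℝ →ₐ[ℝ] ℂ) × Fin 2 => (fun _ : ℝ →ₐ[ℝ] ℂ => (![s₁, s₂] : Fin 2 → ℂ)) p.1 p.2) =
        fun p : (ℝ →ₐ[ℝ] ℂ) × Fin 2 => (![s₁, s₂] : Fin 2 → ℂ) p.2 from rfl] at h
    rw [hev, h]
    simp
  -- generation: `Ψ : ℂ[Y_{τ,k}] → ℂ ⊗ Z(𝔤)`, `Y_{τ,0} ↦ 1 ⊗ Z`, `Y_{τ,1} ↦ 1 ⊗ C + ½`, lifts `blockPsumAeval` along `γ_ℂ`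
  let g : (ℝ →ₐ[ℝ] ℂ) × Fin 2 → ℂ ⊗[ℝ] (Subalgebra.center ℝ (UniversalEnvelopingAlgebra ℝ (Matrix (Fin 2) (Fin 2) ℝ))) := fun p =>
    if p.2 = 0 then (1 : ℂ) ⊗ₜ zedZ 2 else (1 : ℂ) ⊗ₜ casimirZ 2 + algebraMap ℂ _ (1 / 2 : ℂ)
  let Ψ : MvPolynomial ((ℝ →ₐ[ℝ] ℂ) × Fin 2) ℂ →ₐ[ℂ] ℂ ⊗[ℝ] (Subalgebra.center ℝ (UniversalEnvelopingAlgebra ℝ (Matrix (Fin 2) (Fin 2) ℝ))) := MvPolynomial.aeval g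
  have hgS : ∀ p, g p ∈ S := by
    intro p
    by_cases hp : p.2 = 0
    · simp only [g, if_pos hp]; exact hZmem
    · simp only [g, if_neg hp]
      exact add_mem hCmem (S.algebraMap_mem _)
  have hΨS : ∀ G, Ψ G ∈ S := by
    intro G
    have hr : Ψ.range ≤ S := by
      rw [MvPolynomial.aeval_range, Algebra.adjoin_le_iff]
      rintro _ ⟨p, rfl⟩
      exact hgS p
    exact hr ⟨G, rfl⟩
  have hγΨ : γ.baseChange.comp Ψ = blockPsumAeval (ℝ →ₐ[ℝ] ℂ) 2 ℂ := by
    apply MvPolynomial.algHom_ext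
    rintro ⟨τ, k⟩
    have hτ : τ = τ₀ := Subsingleton.elim _ _
    subst hτ
    rw [AlgHom.comp_apply, blockPsumAeval, MvPolynomial.aeval_X, MvPolynomial.aeval_X]
    fin_cases k
    · simp only [g, Fin.zero_eta, if_true]
      rw [HarishChandraHomGL.baseChange_tmul, one_smul, harishChandra_zedZ_eq γ τ₀]
    · simp only [g, Fin.mk_one, one_ne_zero, if_false]
      rw [map_add, HarishChandraHomGL.baseChange_tmul, one_smul, harishChandra_casimirZ_eq γ τ₀,
        AlgHom.commutes, MvPolynomial.algebraMap_eq]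
      ring
  -- every `1 ⊗ u` lies in `S`
  obtain ⟨hinj, hrange⟩ := γ.baseChange_injective_and_range_eq
  have hmem : (1 : ℂ) ⊗ₜ u ∈ S := by
    have h1 : γ.baseChange ((1 : ℂ) ⊗ₜ u) ∈ (blockPsumAeval (ℝ →ₐ[ℝ] ℂ) 2 ℂ).range := by
      rw [range_blockPsumAeval, ← symmetricSubalgebraGL_eq_blockSymmetricSubalgebra, ← hrange]
      exact ⟨_, rfl⟩
    obtain ⟨G, hG⟩ := h1
    have h2 : γ.baseChange (Ψ G) = γ.baseChange ((1 : ℂ) ⊗ₜ u) := by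
      rw [← AlgHom.comp_apply, hγΨ]
      exact hG
    rw [← hinj h2]
    exact hΨS G
  rw [hS, hact, one_smul, hθC, one_mul] at hmem
  exact hmem

/-- **Packaged form: the centre acts through a character.** Under the hypotheses of
`lift_center_apply_eq_smul_of_casimir_of_zed` there is a real algebra character
`θ : Z(𝔤𝔩₂(ℝ)) →ₐ[ℝ] ℂ` with `u v = θ(u) v` for every central `u`, `θ(Z) = s₁ + s₂` and
`θ(C) = s₁² + s₂² - ½` (namely `θ = ev_{(s₁,s₂)} ∘ γ`). In particular the `Z(𝔤)`-orbit of `v`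
spans at most a line. [cite: Knapp2002, §V.5 Thm. 5.44] [cite: Bump1997, §2.2] -/
theorem exists_character_lift_center_apply_eq_smul {v : V} {s₁ s₂ : ℂ}
    (hC : lift ℝ ρ (casimir 2) v = (s₁ ^ 2 + s₂ ^ 2 - 1 / 2) • v)
    (hZ : lift ℝ ρ (zed 2) v = (s₁ + s₂) • v) :
    ∃ θ : Subalgebra.center ℝ (UniversalEnvelopingAlgebra ℝ (Matrix (Fin 2) (Fin 2) ℝ)) →ₐ[ℝ] ℂ,
      θ (zedZ 2) = s₁ + s₂ ∧ θ (casimirZ 2) = s₁ ^ 2 + s₂ ^ 2 - 1 / 2 ∧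
      ∀ u : Subalgebra.center ℝ (UniversalEnvelopingAlgebra ℝ (Matrix (Fin 2) (Fin 2) ℝ)),
        lift ℝ ρ (u : UniversalEnvelopingAlgebra ℝ (Matrix (Fin 2) (Fin 2) ℝ)) v = θ u • v := by
  let τ₀ : ℝ →ₐ[ℝ] ℂ := Algebra.ofId ℝ ℂ
  let ev : MvPolynomial ((ℝ →ₐ[ℝ] ℂ) × Fin 2) ℂ →ₐ[ℂ] ℂ :=
    MvPolynomial.aeval (fun p : (ℝ →ₐ[ℝ] ℂ) × Fin 2 => (![s₁, s₂] : Fin 2 → ℂ) p.2)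
  refine ⟨(ev.restrictScalars ℝ).comp (harishChandraHomGL ℝ 2).toAlgHom, ?_, ?_, fun u => ?_⟩
  · change ev ((harishChandraHomGL ℝ 2).toAlgHom (zedZ 2)) = _
    rw [harishChandra_zedZ_eq _ τ₀]
    simp [ev, bpsum, psum, Fin.sum_univ_two]
  · change ev ((harishChandraHomGL ℝ 2).toAlgHom (casimirZ 2)) = _
    rw [harishChandra_casimirZ_eq _ τ₀]
    simp [ev, bpsum, psum, Fin.sum_univ_two]
  · exact lift_center_apply_eq_smul_of_casimir_of_zed ρ hC hZ u

end Main

end GL2Casimir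

end Literature.NumberTheory.Automorphic
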